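import Mathlib.Algebra.MvPolynomial.PDeriv
import Mathlib.Algebra.MvPolynomial.Monad
import Mathlib.Algebra.MvPolynomial.Variables
import Mathlib.Algebra.MvPolynomial.Equiv
import Mathlib.RingTheory.MvPolynomial.Basic
import Mathlib.Algebra.Order.Antidiag.FinsuppEquiv
import Mathlib.LinearAlgebra.Matrix.Nondegenerate
import Mathlib.LinearAlgebra.Dimension.Finite
import Mathlib.Algebra.Order.Ring.Pow
import Mathlib.Data.Real.Basic
import Mathlib.Tactic.Positivity
import Mathlib.Tactic.FieldSimp
import Mathlib.Tactic.Ring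
import Mathlib.Tactic.Linarith
import Literature.NumberTheory.LFunctions.WooleyPolyToolkit
import HarnessLib

/-!
# Wooley's eliminant: `Ψ(H₁,…,H_n, x₀) = 0` with `deg_{y₀} Ψ ≤ ∏ deg Hⱼ`

Topic `Literature/NumberTheory/LFunctions` (toolkit for Wooley's theorem on simultaneous
congruences). Everything here is PROVED.

For `n` polynomials `H₁,…,H_n ∈ ℚ[x₀,…,x_{n-1}]` with `deg Hⱼ ≤ Kⱼ` (`Kⱼ ≥ 1`) and a nonvanishing
Jacobian determinant, there is a nonzero `Ψ ∈ ℚ[y₀, y₁, …, y_n]` of positive degree at most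
`K₁⋯K_n` in `y₀` with `Ψ(x₀, H₁, …, H_n) = 0` (`Wooley.exists_eliminant`). The existence of some
nonzero `Ψ` of `y₀`-degree `≤ B = ∏ Kⱼ` is linear algebra: the monomials `H^a x₀^b`
(`∑ Kⱼaⱼ + b ≤ D`, `b ≤ B`) outnumber the monomials of degree `≤ D` once `D = B + nB(B+1)`
(`card_pairs_gt_card_mono`, via the closed form `#{c : |c| ≤ m} = C(n+m, n)` and the growth bound
`B·C(n+m+B,n) < (B+1)·C(n+m,n)`); that `Ψ` really involves `y₀` follows by taking `Ψ` of least
total degree and differentiating (`Wooley.pderiv_bind₁`, the Jacobian hypothesis, and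
`Wooley.eq_C_of_pderiv_eq_zero`).

## References

* T. D. Wooley, *A note on simultaneous congruences*, J. Number Theory 58 (1996), 288–297,
  Lemma 2 (specialised: no generic coefficients are needed for a single system). [Wooley1996]
-/

noncomputable section

open MvPolynomial Finset

namespace Literature.NumberTheory.LFunctions
namespace Wooley

/-! ## Counting monomials -/

/-- The tuples `c : Fin k → ℕ` with `∑ cᵢ ≤ m`, as a finset. [folklore] -/
def monoFin (k m : ℕ) : Finset (Fin k → ℕ) :=
  (Fintype.piFinset fun _ : Fin k ↦ range (m + 1)).filter fun c ↦ ∑ i, c i ≤ m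

/-- Membership in `monoFin`. [folklore] -/
theorem mem_monoFin {k m : ℕ} {c : Fin k → ℕ} : c ∈ monoFin k m ↔ ∑ i, c i ≤ m := by
  simp only [monoFin, mem_filter, Fintype.mem_piFinset, mem_range, and_iff_right_iff_imp]
  intro h i
  have := Finset.single_le_sum (f := c) (fun j _ ↦ Nat.zero_le _) (mem_univ i)
  omega

/-- **Stars and bars:** `#{c : Fin k → ℕ | ∑ cᵢ ≤ m} = C(k + m, k)`. [folklore] -/
theorem card_monoFin (k m : ℕ) : (monoFin k m).card = (k + m).choose k := by
  classical
  -- bijection with `{g : Fin (k+1) →₀ ℕ | ∑ g = m}` (slack variable)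
  set T : Finset (Fin (k + 1) →₀ ℕ) := (univ : Finset (Fin (k + 1))).finsuppAntidiag m with hT
  have hTcard : T.card = (k + m).choose k := by
    rw [hT, Finset.card_finsuppAntidiag_nat_eq_choose, card_univ, Fintype.card_fin,
      show k + 1 + m - 1 = k + m by omega, Nat.choose_symm_add]
  rw [← hTcard]
  -- the map
  let F : (Fin k → ℕ) → (Fin (k + 1) →₀ ℕ) := fun c ↦
    Finsupp.equivFunOnFinite.symm (Fin.snoc c (m - ∑ i, c i))
  refine Finset.card_bij (fun c _ ↦ F c) (fun c hc ↦ ?_) (fun c₁ hc₁ c₂ hc₂ h ↦ ?_) (fun g hg ↦ ?_)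
  · rw [mem_monoFin] at hc
    rw [hT, Finset.mem_finsuppAntidiag]
    refine ⟨?_, by simp⟩
    simp only [F, Finsupp.coe_equivFunOnFinite_symm, Fin.sum_univ_castSucc, Fin.snoc_castSucc,
      Fin.snoc_last]
    omega
  · have : Fin.snoc c₁ (m - ∑ i, c₁ i) = (Fin.snoc c₂ (m - ∑ i, c₂ i) : Fin (k + 1) → ℕ) := by
      have := congrArg Finsupp.equivFunOnFinite h
      simpa [F] using this
    have h2 := congrArg Fin.init this
    simpa [Fin.init_snoc] using h2
  · rw [hT, Finset.mem_finsuppAntidiag] at hg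
    refine ⟨Fin.init g, ?_, ?_⟩
    · rw [mem_monoFin]
      have := hg.1
      rw [Fin.sum_univ_castSucc] at this
      simp only [Fin.init]
      omega
    · simp only [F]
      apply Finsupp.equivFunOnFinite.injective
      rw [Equiv.apply_symm_apply]
      have hsum := hg.1
      rw [Fin.sum_univ_castSucc] at hsum
      have : m - ∑ i : Fin k, Fin.init (⇑g) i = g (Fin.last k) := by
        simp only [Fin.init]; omega
      rw [this]
      exact Fin.snoc_init_self _

/-- Growth of the monomial count: `B · C(k+m+B, k) < (B+1) · C(k+m, k)` once `m ≥ kB(B+1)`,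
`B, k ≥ 1`. [cite: Wooley1996, Lemma 2 (proof, (4)–(5))] -/
theorem choose_growth {k m B : ℕ} (hk : 1 ≤ k) (hB : 1 ≤ B) (hm : k * B * (B + 1) ≤ m) :
    B * (k + m + B).choose k < (B + 1) * (k + m).choose k := by
  -- work in `ℝ`
  have key : ∀ t : ℕ, ((k + m + t).choose k : ℝ)
      ≤ ((k + m).choose k : ℝ) * (1 + (k : ℝ) / (m + 1)) ^ t := by
    intro t
    induction t with
    | zero => simp
    | succ t ih =>
      have hN := Nat.choose_mul_succ_eq (k + m + t) k
      -- `C(N,k)·(N+1) = C(N+1,k)·(N+1-k)`, `N = k+m+t`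
      have hsub : k + m + t + 1 - k = m + t + 1 := by omega
      rw [hsub] at hN
      have hR : ((k + m + t).choose k : ℝ) * ((k + m + t : ℕ) + 1)
          = ((k + m + t + 1).choose k : ℝ) * ((m + t + 1 : ℕ) : ℝ) := by exact_mod_cast hN
      have hpos : (0 : ℝ) < ((m + t + 1 : ℕ) : ℝ) := by positivity
      have e : ((k + m + (t + 1)).choose k : ℝ)
          = ((k + m + t).choose k : ℝ) * (((k + m + t : ℕ) : ℝ) + 1) / ((m + t + 1 : ℕ) : ℝ) := by
        rw [show k + m + (t + 1) = k + m + t + 1 by ring, eq_div_iff hpos.ne', ← hR]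
      rw [e, pow_succ]
      have hfac : (((k + m + t : ℕ) : ℝ) + 1) / ((m + t + 1 : ℕ) : ℝ) ≤ 1 + (k : ℝ) / (m + 1) := by
        rw [div_le_iff₀ hpos]
        push_cast
        have hk0 : (0 : ℝ) ≤ k := Nat.cast_nonneg k
        have ht0 : (0 : ℝ) ≤ t := Nat.cast_nonneg t
        have hm0 : (0 : ℝ) ≤ m := Nat.cast_nonneg m
        rw [show (1 + (k : ℝ) / (m + 1)) * ((m : ℝ) + t + 1) = (m + t + 1) + k * ((m + t + 1) / (m + 1)) by
          ring]
        have : (1 : ℝ) ≤ ((m : ℝ) + t + 1) / (m + 1) := by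
          rw [le_div_iff₀ (by positivity)]; linarith
        nlinarith
      have hc0 : (0 : ℝ) ≤ ((k + m + t).choose k : ℝ) := Nat.cast_nonneg _
      calc ((k + m + t).choose k : ℝ) * (((k + m + t : ℕ) : ℝ) + 1) / ((m + t + 1 : ℕ) : ℝ)
          = ((k + m + t).choose k : ℝ) * ((((k + m + t : ℕ) : ℝ) + 1) / ((m + t + 1 : ℕ) : ℝ)) := by
            ring
        _ ≤ (((k + m).choose k : ℝ) * (1 + (k : ℝ) / (m + 1)) ^ t) * (1 + (k : ℝ) / (m + 1)) :=
            mul_le_mul ih hfac (by positivity) (by positivity)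
        _ = _ := by ring
  -- Bernoulli: `(1+y)^B ≤ 1/(1 - By)` for `y = k/(m+1)`, `By < 1/(B+1)`
  set y : ℝ := (k : ℝ) / (m + 1) with hy
  have hm1 : (0 : ℝ) < (m : ℝ) + 1 := by positivity
  have hy0 : 0 ≤ y := by rw [hy]; positivity
  have hBy : (B : ℝ) * y * (B + 1) < 1 := by
    rw [hy]
    have : ((k * B * (B + 1) : ℕ) : ℝ) ≤ m := by exact_mod_cast hm
    push_cast at this
    rw [show (B : ℝ) * (k / (m + 1)) * (B + 1) = (k * B * (B + 1)) / (m + 1) by ring,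
      div_lt_one hm1]
    linarith
  have hB0 : (0 : ℝ) < B := by exact_mod_cast hB
  have hBy1 : (B : ℝ) * y < 1 := by nlinarith
  have hbern : (1 + y) ^ B * (1 - B * y) ≤ 1 := by
    -- `1 - B y/(1+y) ≤ (1/(1+y))^B`
    have h1 : -2 ≤ -(y / (1 + y)) := by
      have : y / (1 + y) ≤ 1 := by rw [div_le_one (by linarith)]; linarith
      linarith
    have h2 := one_add_mul_le_pow h1 B
    have h3 : (1 + -(y / (1 + y))) = 1 / (1 + y) := by field_simp; ring
    rw [h3, one_div_pow] at h2
    have h4 : 1 - (B : ℝ) * y ≤ 1 + B * -(y / (1 + y)) := by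
      have : y / (1 + y) ≤ y := by
        rw [div_le_iff₀ (by linarith)]; nlinarith
      nlinarith
    have hp : 0 < (1 + y) ^ B := by positivity
    calc (1 + y) ^ B * (1 - B * y) ≤ (1 + y) ^ B * (1 / (1 + y) ^ B) :=
          mul_le_mul_of_nonneg_left (h4.trans h2) hp.le
      _ = 1 := by field_simp
  -- conclude in `ℝ`
  have hC0 : (0 : ℝ) < ((k + m).choose k : ℝ) := by
    have : 0 < (k + m).choose k := Nat.choose_pos (by omega)
    exact_mod_cast this
  have hfinal : (B : ℝ) * ((k + m + B).choose k : ℝ) < (B + 1) * ((k + m).choose k : ℝ) := by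
    have h1 := key B
    -- `B (1+y)^B < (B+1)`: from `(1+y)^B (1 - By) ≤ 1` and `(B+1)(1-By) > B`
    have h2 : (B : ℝ) * (1 + y) ^ B < B + 1 := by
      have h1By : 0 < 1 - (B : ℝ) * y := by linarith
      have : (1 + y) ^ B ≤ 1 / (1 - B * y) := by
        rw [le_div_iff₀ h1By]; exact hbern
      have h3 : (B : ℝ) / (1 - B * y) < B + 1 := by
        rw [div_lt_iff₀ h1By]; nlinarith
      calc (B : ℝ) * (1 + y) ^ B ≤ B * (1 / (1 - B * y)) := mul_le_mul_of_nonneg_left this hB0.le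
        _ = B / (1 - B * y) := by ring
        _ < B + 1 := h3
    calc (B : ℝ) * ((k + m + B).choose k : ℝ)
        ≤ B * (((k + m).choose k : ℝ) * (1 + y) ^ B) := mul_le_mul_of_nonneg_left h1 hB0.le
      _ = (B * (1 + y) ^ B) * ((k + m).choose k : ℝ) := by ring
      _ < (B + 1) * ((k + m).choose k : ℝ) := mul_lt_mul_of_pos_right h2 hC0
  exact_mod_cast hfinal

/-! ## The index set of the family `H^a x₀^b` -/

/-- Weighted tuples: `{a : Fin k → ℕ | ∑ Kⱼ aⱼ ≤ x}`. [folklore] -/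
def wset {k : ℕ} (K : Fin k → ℕ) (x : ℕ) : Finset (Fin k → ℕ) :=
  (Fintype.piFinset fun _ : Fin k ↦ range (x + 1)).filter fun a ↦ ∑ j, K j * a j ≤ x

/-- Membership in `wset`. [folklore] -/
theorem mem_wset {k : ℕ} {K : Fin k → ℕ} (hK : ∀ j, 1 ≤ K j) {x : ℕ} {a : Fin k → ℕ} :
    a ∈ wset K x ↔ ∑ j, K j * a j ≤ x := by
  simp only [wset, mem_filter, Fintype.mem_piFinset, mem_range, and_iff_right_iff_imp]
  intro h i
  have h1 := Finset.single_le_sum (f := fun j ↦ K j * a j) (fun j _ ↦ Nat.zero_le _) (mem_univ i)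
  have h2 : a i ≤ K i * a i := Nat.le_mul_of_pos_left _ (hK i)
  have h3 : K i * a i ≤ x := le_trans h1 h
  omega

/-- The index pairs `(a, b)` with `b ≤ B` and `∑ Kⱼ aⱼ + b ≤ D`. [cite: Wooley1996, Lemma 2 (the set S_B)] -/
def pairs {k : ℕ} (K : Fin k → ℕ) (B D : ℕ) : Finset ((Fin k → ℕ) × ℕ) :=
  (wset K D ×ˢ range (B + 1)).filter fun ab ↦ ∑ j, K j * ab.1 j + ab.2 ≤ D

/-- Membership in `pairs`. [folklore] -/
theorem mem_pairs {k : ℕ} {K : Fin k → ℕ} (hK : ∀ j, 1 ≤ K j) {B D : ℕ} {ab : (Fin k → ℕ) × ℕ} :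
    ab ∈ pairs K B D ↔ ab.2 ≤ B ∧ ∑ j, K j * ab.1 j + ab.2 ≤ D := by
  simp only [pairs, mem_filter, mem_product, mem_wset hK, mem_range]
  omega

/-- `#monoFin k x ≤ (∏ Kⱼ) · #wset K x` (division with remainder by the `Kⱼ`). [cite: Wooley1996, Lemma 2 (proof)] -/
theorem card_monoFin_le {k : ℕ} {K : Fin k → ℕ} (hK : ∀ j, 1 ≤ K j) (x : ℕ) :
    (monoFin k x).card ≤ (∏ j, K j) * (wset K x).card := by
  classical
  set R : Finset (Fin k → ℕ) := Fintype.piFinset fun j ↦ range (K j) with hR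
  have hRcard : R.card = ∏ j, K j := by simp [hR, Fintype.card_piFinset]
  rw [← hRcard, ← Finset.card_product]
  refine Finset.card_le_card_of_injOn (fun c ↦ (fun j ↦ c j % K j, fun j ↦ c j / K j)) ?_ ?_
  · intro c hc
    rw [mem_coe, mem_monoFin] at hc
    rw [mem_coe, mem_product, Fintype.mem_piFinset, mem_wset hK]
    refine ⟨fun j ↦ mem_range.2 (Nat.mod_lt _ (hK j)), ?_⟩
    refine le_trans (Finset.sum_le_sum fun j _ ↦ ?_) hc
    exact Nat.mul_div_le (c j) (K j)
  · intro c₁ _ c₂ _ h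
    rw [Prod.mk.injEq] at h
    funext j
    have h1 : c₁ j % K j = c₂ j % K j := congrFun h.1 j
    have h2 : c₁ j / K j = c₂ j / K j := congrFun h.2 j
    rw [← Nat.mod_add_div (c₁ j) (K j), ← Nat.mod_add_div (c₂ j) (K j), h1, h2]

/-- `(B+1) · #wset K (D - B) ≤ #pairs K B D` when `B ≤ D`. [cite: Wooley1996, Lemma 2 (proof)] -/
theorem card_pairs_ge {k : ℕ} {K : Fin k → ℕ} (hK : ∀ j, 1 ≤ K j) {B D : ℕ} (hBD : B ≤ D) :
    (B + 1) * (wset K (D - B)).card ≤ (pairs K B D).card := by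
  classical
  have : ((wset K (D - B)) ×ˢ range (B + 1)).card = (B + 1) * (wset K (D - B)).card := by
    rw [card_product, card_range, mul_comm]
  rw [← this]
  refine Finset.card_le_card fun ab hab ↦ ?_
  rw [mem_product, mem_wset hK, mem_range] at hab
  rw [mem_pairs hK]
  omega

/-- **The family outnumbers the monomials.** With `B = ∏ Kⱼ` and `D = B + k B (B+1)`:
`#monoFin k D < #pairs K B D`. [cite: Wooley1996, Lemma 2 (proof, (4)–(5))] -/
theorem card_pairs_gt_card_mono {k : ℕ} (hk : 1 ≤ k) {K : Fin k → ℕ} (hK : ∀ j, 1 ≤ K j) :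
    (monoFin k ((∏ j, K j) + k * (∏ j, K j) * ((∏ j, K j) + 1))).card
      < (pairs K (∏ j, K j) ((∏ j, K j) + k * (∏ j, K j) * ((∏ j, K j) + 1))).card := by
  set B : ℕ := ∏ j, K j with hB
  set m : ℕ := k * B * (B + 1) with hm
  have hB1 : 1 ≤ B := by
    rw [hB]; exact Finset.one_le_prod' fun j _ ↦ hK j
  have h1 := card_monoFin_le hK (B + m)          -- `M(D) ≤ B · A(D)`, not needed; we use `M(m)`
  have h2 := card_monoFin_le hK m                -- `M(m) ≤ B · A(m)`
  have h3 := card_pairs_ge hK (B := B) (D := B + m) (by omega)   -- `(B+1) A(m) ≤ #pairs`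
  rw [show B + m - B = m by omega] at h3
  have h4 := choose_growth hk hB1 (le_refl m)    -- `B · C(k+m+B,k) < (B+1) · C(k+m,k)`
  rw [card_monoFin] at h2 ⊢
  rw [show k + (B + m) = k + m + B by ring]
  -- `B · #pairs ≥ B (B+1) A(m) ≥ (B+1) M(m) = (B+1) C(k+m,k) > B · C(k+m+B,k)`
  have h5 : B * ((k + m + B).choose k) < B * (pairs K B (B + m)).card := by
    calc B * ((k + m + B).choose k) < (B + 1) * ((k + m).choose k) := h4
      _ ≤ (B + 1) * (B * (wset K m).card) := Nat.mul_le_mul_left _ h2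
      _ = B * ((B + 1) * (wset K m).card) := by ring
      _ ≤ B * (pairs K B (B + m)).card := Nat.mul_le_mul_left _ h3
  clear h1
  exact Nat.lt_of_mul_lt_mul_left h5

/-! ## Linear algebra: a nonzero `Ψ` with `Ψ(x_{i₀}, H) = 0` and `deg_{y₀} Ψ ≤ ∏ Kⱼ` -/

section PartA

variable {k : ℕ}

/-- The monomial set `{c : Fin k →₀ ℕ | |c| ≤ D}` is in bijection with `monoFin k D`. [folklore] -/
def monoSetEquiv (k D : ℕ) :
    {c : Fin k →₀ ℕ | (c.sum fun _ e ↦ e) ≤ D} ≃ (monoFin k D : Finset (Fin k → ℕ)) where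
  toFun c := ⟨⇑c.1, by
    have h := c.2
    simp only [Set.mem_setOf_eq] at h
    rw [mem_monoFin, ← Finsupp.sum_fintype c.1 (fun _ e ↦ e) (fun _ ↦ rfl)]
    exact h⟩
  invFun f := ⟨Finsupp.equivFunOnFinite.symm f.1, by
    have h := f.2
    rw [mem_monoFin] at h
    simp only [Set.mem_setOf_eq]
    rw [Finsupp.sum_fintype _ _ (fun _ ↦ rfl)]
    simpa using h⟩
  left_inv c := by ext i; simp
  right_inv f := by ext i; simp

/-- Exponent vectors of bounded degree form a finite type. [folklore] -/
instance monoSet_fintype (k D : ℕ) : Fintype {c : Fin k →₀ ℕ | (c.sum fun _ e ↦ e) ≤ D} :=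
  Fintype.ofEquiv _ (monoSetEquiv k D).symm

/-- The number of exponent vectors of degree `≤ D` is `|monoFin k D|`. [folklore] -/
theorem card_monoSet (k D : ℕ) :
    Fintype.card {c : Fin k →₀ ℕ | (c.sum fun _ e ↦ e) ≤ D} = (monoFin k D).card := by
  rw [Fintype.card_congr (monoSetEquiv k D)]
  simp

/-- The exponent vector `(b, a₁, …, a_k)` of the monomial `y₀^b y₁^{a₁} ⋯ y_k^{a_k}`. [folklore] -/
def expo (ab : (Fin k → ℕ) × ℕ) : Fin (k + 1) →₀ ℕ :=
  Finsupp.equivFunOnFinite.symm (Fin.cons ab.2 ab.1)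

/-- The `y₀`-exponent of `expo`. [folklore] -/
theorem expo_zero (ab : (Fin k → ℕ) × ℕ) : expo ab 0 = ab.2 := by simp [expo]

/-- The `yⱼ`-exponents of `expo`. [folklore] -/
theorem expo_succ (ab : (Fin k → ℕ) × ℕ) (j : Fin k) : expo ab j.succ = ab.1 j := by simp [expo]

/-- `expo` is injective. [folklore] -/
theorem expo_injective : Function.Injective (expo (k := k)) := by
  intro x y h
  have h0 := congrArg (fun e ↦ e 0) h
  have hs := fun j ↦ congrArg (fun e ↦ e (Fin.succ j)) h
  simp only [expo_zero, expo_succ] at h0 hs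
  exact Prod.ext (funext hs) h0

/-- `bind₁ θ (monomial (expo (a,b)) 1) = (θ 0)^b ∏ⱼ (θ (succ j))^{aⱼ}`. [folklore] -/
theorem bind₁_monomial_expo (θ : Fin (k + 1) → MvPolynomial (Fin k) ℚ) (ab : (Fin k → ℕ) × ℕ) :
    bind₁ θ (monomial (expo ab) 1) = θ 0 ^ ab.2 * ∏ j, θ j.succ ^ ab.1 j := by
  classical
  rw [bind₁_monomial, C_1, one_mul]
  have : ∏ i ∈ (expo ab).support, θ i ^ (expo ab) i = ∏ i, θ i ^ (expo ab) i := by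
    apply Finset.prod_subset (Finset.subset_univ _)
    intro i _ hi
    rw [Finsupp.notMem_support_iff.1 hi, pow_zero]
  rw [this, Fin.prod_univ_succ, expo_zero]
  simp [expo_succ]

/-- **A nonzero eliminant of controlled `y₀`-degree.** For `H : Fin k → ℚ[x]` (`k ≥ 1`) with
`deg Hⱼ ≤ Kⱼ`, `Kⱼ ≥ 1`, there is `Ψ ≠ 0` in `k + 1` variables with `deg_{y₀} Ψ ≤ ∏ Kⱼ` and
`Ψ(x_{i₀}, H₁, …, H_k) = 0`. [cite: Wooley1996, Lemma 2 (i)–(iii)] -/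
theorem exists_psi_aux (hk : 1 ≤ k) (H : Fin k → MvPolynomial (Fin k) ℚ) (K : Fin k → ℕ)
    (hK : ∀ j, (H j).totalDegree ≤ K j) (hK1 : ∀ j, 1 ≤ K j) (i₀ : Fin k) :
    ∃ Ψ : MvPolynomial (Fin (k + 1)) ℚ, Ψ ≠ 0 ∧ degreeOf 0 Ψ ≤ ∏ j, K j ∧
      bind₁ (Fin.cons (X i₀) H) Ψ = 0 := by
  classical
  set B : ℕ := ∏ j, K j with hB
  set D : ℕ := B + k * B * (B + 1) with hD
  set S : Finset ((Fin k → ℕ) × ℕ) := pairs K B D with hS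
  set θ : Fin (k + 1) → MvPolynomial (Fin k) ℚ := Fin.cons (X i₀) H with hθ
  -- the ambient space and its dimension
  set V : Submodule ℚ (MvPolynomial (Fin k) ℚ) := restrictTotalDegree (Fin k) ℚ D with hV
  let bV : Module.Basis {c : Fin k →₀ ℕ | (c.sum fun _ e ↦ e) ≤ D} ℚ V :=
    basisRestrictSupport ℚ {c : Fin k →₀ ℕ | (c.sum fun _ e ↦ e) ≤ D}
  haveI : Module.Finite ℚ V := Module.Finite.of_basis bV
  have hrank : Module.finrank ℚ V = (monoFin k D).card := by
    rw [Module.finrank_eq_card_basis bV, card_monoSet]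
  -- the family
  have hmem : ∀ ab ∈ S, (θ 0 ^ ab.2 * ∏ j, θ j.succ ^ ab.1 j) ∈ V := by
    intro ab hab
    rw [hS, mem_pairs hK1] at hab
    rw [hV, mem_restrictTotalDegree]
    refine (totalDegree_mul _ _).trans ?_
    have h1 : (θ 0 ^ ab.2).totalDegree ≤ ab.2 := by
      refine (totalDegree_pow _ _).trans ?_
      rw [hθ, Fin.cons_zero]
      calc ab.2 * (X i₀ : MvPolynomial (Fin k) ℚ).totalDegree ≤ ab.2 * 1 :=
            Nat.mul_le_mul_left _ (by rw [totalDegree_X])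
        _ = ab.2 := mul_one _
    have h2 : (∏ j, θ j.succ ^ ab.1 j).totalDegree ≤ ∑ j, K j * ab.1 j := by
      refine (totalDegree_finsetProd _ _).trans (Finset.sum_le_sum fun j _ ↦ ?_)
      refine (totalDegree_pow _ _).trans ?_
      calc ab.1 j * (θ j.succ).totalDegree ≤ ab.1 j * K j :=
            Nat.mul_le_mul_left _ (by rw [hθ, Fin.cons_succ]; exact hK j)
        _ = K j * ab.1 j := mul_comm _ _
    omega
  let fam : S → V := fun ab ↦ ⟨θ 0 ^ ab.1.2 * ∏ j, θ j.succ ^ ab.1.1 j, hmem ab.1 ab.2⟩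
  -- it is linearly dependent
  have hdep : ¬ LinearIndependent ℚ fam := by
    intro hli
    have h1 := hli.fintype_card_le_finrank
    rw [hrank, Fintype.card_coe] at h1
    have h2 := card_pairs_gt_card_mono hk hK1
    rw [← hB, ← hD, ← hS] at h2
    omega
  obtain ⟨g, hg0, i₁, hi₁⟩ := Fintype.not_linearIndependent_iff.1 hdep
  -- the eliminant
  refine ⟨∑ i : S, g i • monomial (expo i.1) (1 : ℚ), ?_, ?_, ?_⟩
  · -- nonzero: the coefficient at `expo i₁` is `g i₁`
    intro h0
    have hc := congrArg (coeff (expo i₁.1)) h0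
    rw [coeff_sum, coeff_zero] at hc
    simp only [coeff_smul, coeff_monomial, smul_eq_mul, mul_ite, mul_one, mul_zero] at hc
    rw [Finset.sum_eq_single i₁] at hc
    · simp at hc; exact hi₁ hc
    · intro b _ hb
      rw [if_neg]
      intro h
      exact hb (Subtype.ext (expo_injective h))
    · intro h; exact absurd (Finset.mem_univ _) h
  · -- degree in `y₀`
    rw [degreeOf_le_iff]
    intro m hm
    have hsub := (Finset.mem_of_subset support_sum hm)
    rw [Finset.mem_biUnion] at hsub
    obtain ⟨i, _, hi⟩ := hsub
    have hi' := Finset.mem_of_subset support_smul hi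
    have hi'' := Finset.mem_of_subset support_monomial_subset hi'
    rw [Finset.mem_singleton] at hi''
    rw [hi'', expo_zero]
    have hiS : (i : (Fin k → ℕ) × ℕ) ∈ pairs K B D := i.2
    rw [mem_pairs hK1] at hiS
    rw [hB]; exact hiS.1
  · -- the relation
    rw [map_sum]
    have : ∀ i : S, bind₁ θ (g i • monomial (expo i.1) (1 : ℚ)) = g i • (fam i : MvPolynomial (Fin k) ℚ) := by
      intro i
      rw [map_smul, bind₁_monomial_expo]
    simp_rw [this]
    have h := congrArg (Subtype.val : V → MvPolynomial (Fin k) ℚ) hg0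
    rw [Submodule.coe_zero] at h
    rw [← h]
    simp

end PartA

/-! ## Minimal degree: the eliminant involves `y₀` -/

/-- A left inverse of `rename Fin.succ` shows it preserves the total degree. [folklore] -/
theorem totalDegree_rename_succ {k : ℕ} (i₀ : Fin k) (q : MvPolynomial (Fin k) ℚ) :
    (rename Fin.succ q : MvPolynomial (Fin (k + 1)) ℚ).totalDegree = q.totalDegree := by
  refine le_antisymm (totalDegree_rename_le _ _) ?_
  let g : Fin (k + 1) → Fin k := fun v ↦ if h : v = 0 then i₀ else v.pred h
  have hg : g ∘ Fin.succ = id := by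
    funext j; simp [g, Fin.succ_ne_zero]
  calc q.totalDegree = (rename g (rename Fin.succ q)).totalDegree := by
        rw [rename_rename, hg]; simp
    _ ≤ (rename Fin.succ q).totalDegree := totalDegree_rename_le _ _

/-- **Wooley's eliminant.** For a square system `H : Fin k → ℚ[x₀,…,x_{k-1}]` (`k ≥ 1`) with
`deg Hⱼ ≤ Kⱼ` (`Kⱼ ≥ 1`) and `det (∂ᵢ Hⱼ) ≠ 0`, and any coordinate `x_{i₀}`, there is a nonzero
`Ψ ∈ ℚ[y₀, …, y_k]` with `0 < deg_{y₀} Ψ ≤ ∏ Kⱼ` and `Ψ(x_{i₀}, H₁, …, H_k) = 0`.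
[cite: Wooley1996, Lemma 2] -/
theorem exists_eliminant {k : ℕ} (hk : 1 ≤ k) (H : Fin k → MvPolynomial (Fin k) ℚ) (K : Fin k → ℕ)
    (hK : ∀ j, (H j).totalDegree ≤ K j) (hK1 : ∀ j, 1 ≤ K j) (i₀ : Fin k)
    (hJ : (Matrix.of fun j i ↦ pderiv i (H j)).det ≠ 0) :
    ∃ Ψ : MvPolynomial (Fin (k + 1)) ℚ, Ψ ≠ 0 ∧ 0 < degreeOf 0 Ψ ∧ degreeOf 0 Ψ ≤ ∏ j, K j ∧
      bind₁ (Fin.cons (X i₀) H) Ψ = 0 := by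
  classical
  set B : ℕ := ∏ j, K j with hB
  set θ : Fin (k + 1) → MvPolynomial (Fin k) ℚ := Fin.cons (X i₀) H with hθ
  -- polynomials with the three properties, of total degree `t`
  let P : ℕ → Prop := fun t ↦ ∃ Ψ : MvPolynomial (Fin (k + 1)) ℚ,
    Ψ ≠ 0 ∧ degreeOf 0 Ψ ≤ B ∧ bind₁ θ Ψ = 0 ∧ Ψ.totalDegree = t
  have hex : ∃ t, P t := by
    obtain ⟨Ψ, h1, h2, h3⟩ := exists_psi_aux hk H K hK hK1 i₀
    exact ⟨_, Ψ, h1, h2, h3, rfl⟩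
  obtain ⟨Ψ, hΨ0, hΨB, hΨrel, hΨdeg⟩ := Nat.find_spec hex
  have hmin : ∀ t < Nat.find hex, ¬ P t := fun t ht ↦ Nat.find_min hex ht
  refine ⟨Ψ, hΨ0, ?_, hΨB, hΨrel⟩
  rw [pos_iff_ne_zero]
  intro hdeg0
  -- `Ψ` does not involve `y₀`: `Ψ = rename succ Ψ₀`
  have hvars : (↑Ψ.vars : Set (Fin (k + 1))) ⊆ Set.range Fin.succ := by
    intro v hv
    rw [Finset.mem_coe, mem_vars_iff_degreeOf_ne_zero] at hv
    have hv0 : v ≠ 0 := by rintro rfl; exact hv hdeg0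
    exact Fin.exists_succ_eq.2 hv0
  obtain ⟨Ψ₀, hΨ₀⟩ := exists_rename_eq_of_vars_subset_range Ψ Fin.succ (Fin.succ_injective k) hvars
  have hθsucc : θ ∘ Fin.succ = H := by funext j; simp [hθ]
  have hrel₀ : bind₁ H Ψ₀ = 0 := by
    rw [← hθsucc, ← bind₁_rename, hΨ₀]; exact hΨrel
  have hΨ₀ne : Ψ₀ ≠ 0 := by rintro rfl; rw [map_zero] at hΨ₀; exact hΨ0 hΨ₀.symm
  -- differentiate: `∑ᵢ bind₁ H (∂ᵢ Ψ₀) ∂ₖ Hᵢ = 0`, so `bind₁ H (∂ᵢ Ψ₀) = 0` for all `i`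
  set u : Fin k → MvPolynomial (Fin k) ℚ := fun i ↦ bind₁ H (pderiv i Ψ₀) with hu
  have hvec : Matrix.vecMul u (Matrix.of fun j i ↦ pderiv i (H j)) = 0 := by
    funext kk
    have h := congrArg (pderiv kk) hrel₀
    rw [map_zero, pderiv_bind₁] at h
    rw [Pi.zero_apply, ← h]
    simp [Matrix.vecMul, dotProduct, hu]
  have hu0 : u = 0 := Matrix.eq_zero_of_vecMul_eq_zero hJ hvec
  by_cases hall : ∀ i, pderiv i Ψ₀ = 0
  · -- then `Ψ₀` is a nonzero constant, contradiction with `bind₁ H Ψ₀ = 0`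
    have hC := eq_C_of_pderiv_eq_zero hall
    have hc0 : coeff 0 Ψ₀ ≠ 0 := by
      intro h0; apply hΨ₀ne; rw [hC, h0, C_0]
    apply hc0
    have : bind₁ H Ψ₀ = C (coeff 0 Ψ₀) := by rw [hC]; simp
    rw [hrel₀] at this
    have := congrArg (coeff 0) this
    simpa using this.symm
  · push Not at hall
    obtain ⟨i, hi⟩ := hall
    -- `Ψ' = rename succ (∂ᵢ Ψ₀)` has the three properties and smaller total degree
    have hui : bind₁ H (pderiv i Ψ₀) = 0 := by
      have := congrFun hu0 i; simpa [hu] using this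
    apply hmin (rename Fin.succ (pderiv i Ψ₀) : MvPolynomial (Fin (k + 1)) ℚ).totalDegree
    · rw [← hΨdeg, ← hΨ₀, totalDegree_rename_succ i₀, totalDegree_rename_succ i₀]
      exact totalDegree_pderiv_lt hi
    · refine ⟨rename Fin.succ (pderiv i Ψ₀), ?_, ?_, ?_, rfl⟩
      · exact fun h ↦ hi (rename_injective _ (Fin.succ_injective k) (by rw [h, map_zero]))
      · rw [degreeOf_le_iff]
        intro m hm
        rw [support_rename_of_injective (Fin.succ_injective k), Finset.mem_image] at hm
        obtain ⟨d, _, rfl⟩ := hm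
        rw [Finsupp.mapDomain_notin_range _ _ (by simp)]
        exact Nat.zero_le _
      · rw [bind₁_rename, hθsucc]; exact hui

end Wooley
end Literature.NumberTheory.LFunctions
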